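import Mathlib
import Summits.ResolutionOfSingularities.ResolutionOfSingularities.Theorems.RadicialJungCleanModelsCleanLU3CompositeUpstairs
import Summits.ResolutionOfSingularities.ResolutionOfSingularities.Theorems.RadicialJungCleanModelsCleanLU3CompositeDivisorial
import HarnessLib
/-!
# Route `RadicialJung`, crux `CleanModels` (stmt-15917), stub `stub_cleanLU3DefectNonDiscrete`, sub-line (C-div): the UPSTAIRS ASSEMBLY
# re-threaded over the DOWNSTAIRS PACKAGE (workfile v3)

Line `Sketch` rev 24 of crux stmt-ResolutionOfSingularities-15917; lead `res-B-lead-1` g4 (workfile `Lines/Sketch_Cdiv_assembly.lean` v3).  OURS;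
nothing here proves resolution in characteristic `p`.

Workfile v3 withdraws the delegable stub `stub_persistStep` (v2.1) and replaces it by `stub_persistE1` / `stub_persistE2` / `stub_persistCases`;
to keep the upstairs side independent of how the downstairs side is cut, this file re-proves ✓ `cleanLU3Defect_of_heightOneCoarsening_of`
(`…CompositeUpstairs.lean`) and ✓ `cleanLU3Defect_of_divisorialCoarsening_of` (`…CompositeDivisorial.lean`) with the two hypotheses `hLU2`,
`hpersist` replaced by ONE hypothesis `hD2` = the DOWNSTAIRS PACKAGE, i.e. the conclusion of ✓ `exists_cleanMono_stage'` (`…CompositeDownstairsDom.lean`)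
for every residue surface: a quadratic sequence along `Ō` from `locAtCentre Ā Ō` to a regular stage `M` carrying a non-trivial representative
`Σ c_j^p ū^j`, loosely clean in an r.s.p. `(xb, yb)` of the stage, with coefficient denominators a LIST of powers of regular parameters.  The proofs
are those of the two cited theorems verbatim, with the single call of `exists_cleanMono_stage'` replaced by `hD2`.
-/

noncomputable section

set_option linter.dupNamespace false -- mandated namespace of this single-conjunct summit

open IsLocalRing AlgebraicGeometry CategoryTheory
open Literature.AlgebraicGeometry.Resolution

namespace Summit.ResolutionOfSingularities.ResolutionOfSingularities.Theorems.RadicialJung.CleanModels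

/-- **(C-div), height-one case, modulo `hEmb` and the downstairs package `hD2`.**  See the module docstring and
`cleanLU3Defect_of_heightOneCoarsening_of`. [folklore] -/
theorem cleanLU3Defect_of_heightOneCoarsening_of_cleanMono
    (hEmb : ∀ (Z : Scheme.{0}) [IsIntegral Z] [IsNoetherian Z], Scheme.IsRegular Z →
      Scheme.IsExcellent Z → ∀ (X : Set Z), IsClosed X → X ≠ Set.univ → topologicalKrullDim X ≤ 2 →
        ∃ (Z' : Scheme.{0}) (π : Z' ⟶ Z), IsProper π ∧ Function.Surjective π.base ∧
          (∃ U : Z.Opens, (U : Set Z) = Xᶜ ∧ IsIso (π ∣_ U)) ∧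
          IsStrictNormalCrossingsDivisor Z' (π.base ⁻¹' X))
    (p : ℕ) (hp : p.Prime) (k : Type) [Field k] [CharP k p]
    (hD2 : ∀ (κ : Type) [Field κ] [CharP κ p] [Algebra k κ]
      (Ō : ValuationSubring κ) (Ā : Subalgebra k κ), Ā.toSubring ≤ Ō.toSubring → Ā.FG → IsFractionRing Ā κ →
      IsRegularLocalRing (locAtCentre Ā.toSubring Ō) →
      ringKrullDim (locAtCentre Ā.toSubring Ō) = 2 →
      (∀ (T : Subring κ) (hT : T ≤ Ō.toSubring), Ā.toSubring ≤ T → (subringCentre T Ō hT).IsMaximal) →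
      ∀ ū : κ, (∀ c : κ, c ^ p ≠ ū) →
      ∃ (Rb : ℕ → Subring κ), Rb 0 = locAtCentre Ā.toSubring Ō ∧ (∀ i, IsQuadraticTransformAlong Ō (Rb i) (Rb (i + 1))) ∧
        ∃ (M : ℕ) (_ : IsRegularLocalRing (Rb M)), ringKrullDim (Rb M) = 2 ∧
        ∃ (c : Fin p → κ), (∃ j : Fin p, (j : ℕ) ≠ 0 ∧ c j ≠ 0) ∧
        ∃ (xb yb : Rb M), (xb : κ) ≠ 0 ∧ (yb : κ) ≠ 0 ∧ maximalIdeal (Rb M) = Ideal.span {xb, yb} ∧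
        ∃ (Lb : List (κ × κ × ℕ)),
          (∀ t ∈ Lb, t.1 ≠ 0 ∧ ∃ (h₁ : t.1 ∈ Rb M) (h₂ : t.2.1 ∈ Rb M), maximalIdeal (Rb M) = Ideal.span {⟨_, h₁⟩, ⟨_, h₂⟩}) ∧
          (∀ j : Fin p, c j * (Lb.map fun t => t.1 ^ t.2.2).prod ∈ Rb M) ∧
          ((∃ (a b : ℕ) (ε : Rb M), IsUnit ε ∧ (a ≠ 0 ∨ b ≠ 0) ∧ (a = 0 ∨ ¬ p ∣ a) ∧ (b = 0 ∨ ¬ p ∣ b) ∧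
              (∑ j : Fin p, c j ^ p * ū ^ (j : ℕ)) = (ε : κ) * (xb : κ) ^ a * (yb : κ) ^ b) ∨
            (∃ w : Rb M, IsUnit w ∧ (∑ j : Fin p, c j ^ p * ū ^ (j : ℕ)) = (w : κ) ∧ ∀ c' : Rb M, w - c' ^ p ∉ maximalIdeal (Rb M)) ∨
            (∃ s c' : Rb M, (∑ j : Fin p, c j ^ p * ū ^ (j : ℕ)) = (s : κ) ∧ s - c' ^ p ∈ maximalIdeal (Rb M) ∧
              s - c' ^ p ∉ maximalIdeal (Rb M) ^ 2)))
    (K : Type) [Field K] [Algebra k K]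
    (O : ValuationSubring K) (A : Subalgebra k K) (hAO : A.toSubring ≤ O.toSubring) (hAfg : A.FG)
    (hfrac : IsFractionRing A K)
    (hreg : IsRegularLocalRing (locAtCentre A.toSubring O))
    (hdim3 : ringKrullDim (locAtCentre A.toSubring O) = 3)
    (hzd : ∀ (T : Subring K) (hT : T ≤ O.toSubring), A.toSubring ≤ T → (subringCentre T O hT).IsMaximal)
    (g₀ : K) (hg₀ : ∀ c : K, c ^ p ≠ g₀)
    (hdefect : ∀ f₀ : K, ∃ f₁ : K, O.valuation (g₀ - f₁ ^ p) < O.valuation (g₀ - f₀ ^ p))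
    (O₁ : ValuationSubring K) (hOO₁ : O ≤ O₁) (hO₁ : O₁ ≠ ⊤)
    (hloc : locAtCentre (locAtCentre A.toSubring O) O₁ = O₁.toSubring) :
    ∃ (A' : Subalgebra k K), A'.toSubring ≤ O.toSubring ∧ A ≤ A' ∧ A'.FG ∧
    ∃ (_ : IsRegularLocalRing (locAtCentre A'.toSubring O)) (c : Fin p → K), (∃ j : Fin p, (j : ℕ) ≠ 0 ∧ c j ≠ 0) ∧
    ((∃ (d m : ℕ) (hmd : m ≤ d) (t : Fin d → ↥(locAtCentre A'.toSubring O)) (a : Fin m → ℕ) (u : ↥(locAtCentre A'.toSubring O)), IsUnit u ∧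
    Ideal.span (Set.range t) = IsLocalRing.maximalIdeal ↥(locAtCentre A'.toSubring O) ∧
    ringKrullDim ↥(locAtCentre A'.toSubring O) = (d : WithBot ℕ∞) ∧ 0 < m ∧ (∀ i, ¬ p ∣ a i) ∧
    (∑ j : Fin p, c j ^ p * g₀ ^ (j : ℕ)) = (u : K) * ∏ i : Fin m, ((t (Fin.castLE hmd i) : ↥(locAtCentre A'.toSubring O)) : K) ^ (a i)) ∨
    (∃ u : ↥(locAtCentre A'.toSubring O), IsUnit u ∧ (∑ j : Fin p, c j ^ p * g₀ ^ (j : ℕ)) = (u : K) ∧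
    ∀ c' : ↥(locAtCentre A'.toSubring O), u - c' ^ p ∉ IsLocalRing.maximalIdeal ↥(locAtCentre A'.toSubring O)) ∨
    (∃ s c' : ↥(locAtCentre A'.toSubring O), (∑ j : Fin p, c j ^ p * g₀ ^ (j : ℕ)) = (s : K) ∧
    s - c' ^ p ∈ IsLocalRing.maximalIdeal ↥(locAtCentre A'.toSubring O) ∧
    s - c' ^ p ∉ IsLocalRing.maximalIdeal ↥(locAtCentre A'.toSubring O) ^ 2)) := by
  classical
  haveI : Fact p.Prime := ⟨hp⟩
  haveI : CharP K p := charP_of_injective_algebraMap (algebraMap k K).injective p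
  haveI : IsFractionRing A K := hfrac
  have hp0 : p ≠ 0 := hp.ne_zero
  set S : Subring K := locAtCentre A.toSubring O with hSdef
  have hSO : S ≤ O.toSubring := locAtCentre_le hAO
  have hAS : A.toSubring ≤ S := le_locAtCentre A.toSubring O
  have hdimA : ringKrullDim A = 3 := by
    rw [← ringKrullDim_locAtCentre_eq_of_isMaximal A hAfg O hAO (hzd _ hAO le_rfl)]; exact hdim3
  -- an element of the model in the centre of `O₁` (as `O₁ ≠ K`)
  have hcentre : ∃ b : K, b ∈ A ∧ b ≠ 0 ∧ O₁.valuation b < 1 := by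
    by_contra hnone
    push Not at hnone
    apply hO₁
    rw [eq_top_iff]
    intro x _
    obtain ⟨a, b, hb, rfl⟩ := IsFractionRing.div_surjective (A := A) x
    have hb0 : (b : K) ≠ 0 := by
      intro h
      have : (b : A) = 0 := Subtype.ext h
      rw [this] at hb; exact zero_notMem_nonZeroDivisors hb
    have hvb : O₁.valuation (b : K) = 1 :=
      le_antisymm ((O₁.valuation_le_one_iff _).mpr (hOO₁ (hAO b.2))) (hnone _ b.2 hb0)
    change (a : K) / (b : K) ∈ O₁
    rw [← O₁.valuation_le_one_iff, map_div₀, hvb, div_one, O₁.valuation_le_one_iff]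
    exact hOO₁ (hAO a.2)
  obtain ⟨t₀, ht₀A, ht₀0, hv₁t₀⟩ := hcentre
  -- THE FRAME
  obtain ⟨A₁, hAA₁, hA₁fg, hA₁O, hreg₁, hdim₁, hSR₁, t, t₂, t₃, ht, ht₂, ht₃, hmax₁, hvt, hvt₂, hvt₃⟩ :=
    exists_frame_of_coarsening hEmb k O A hAO hAfg hfrac hreg hdim3 hzd O₁ hOO₁ hloc t₀ (hAS ht₀A) ht₀0 hv₁t₀
  set R₁ : Subring K := locAtCentre A₁.toSubring O with hR₁def
  haveI := hreg₁
  have hR₁O : R₁ ≤ O.toSubring := locAtCentre_le hA₁O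
  have hR₁O₁ : R₁ ≤ O₁.toSubring := fun z hz => hOO₁ (hR₁O hz)
  have hzd₁ : ∀ (T : Subring K) (hT : T ≤ O.toSubring), A₁.toSubring ≤ T → (subringCentre T O hT).IsMaximal :=
    fun T hT hA₁T => hzd T hT (fun z hz => hA₁T (hAA₁ hz))
  have hloc₁ : locAtCentre R₁ O₁ = O₁.toSubring :=
    le_antisymm (locAtCentre_le hR₁O₁) (by rw [← hloc]; exact locAtCentre_mono O₁ hSR₁)
  have hloc₁' : O₁.toSubring ≤ locAtCentre R₁ O₁ := hloc₁.symm.le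
  have hfrac₁ : IsFractionRing A₁ K := isFractionRing_of_le hAA₁ hfrac
  have ht0 : t ≠ 0 := by
    intro h; rw [h, map_zero] at hvt
    -- `0 < 1` is fine, but we need `t ≠ 0` for the uniformiser: `v₁ t₂ = 1` forces a nonzero centre element; use `t₀` instead? We know
    -- `t` is part of a regular system of parameters of a domain of dimension 3, hence nonzero:
    exact absurd hvt (by
      have htm : (⟨t, ht⟩ : R₁) ∈ ({⟨t, ht⟩, ⟨t₂, ht₂⟩, ⟨t₃, ht₃⟩} : Set R₁) := Or.inl rfl
      have : Prime (⟨t, ht⟩ : R₁) := prime_of_rsop_three R₁ hdim₁ _ _ _ hmax₁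
      exact absurd (Subtype.ext h : (⟨t, ht⟩ : R₁) = 0) this.ne_zero)
  have htprime : Prime (⟨t, ht⟩ : R₁) := prime_of_rsop_three R₁ hdim₁ _ _ _ hmax₁
  -- NORMALISE `g₀` into `A`: `g₁ := b^p g₀ ∈ A`
  obtain ⟨ga, gb, hgb, hg₀eq⟩ := IsFractionRing.div_surjective (A := A) g₀
  have hgb0 : (gb : K) ≠ 0 := by
    intro h
    have : (gb : A) = 0 := Subtype.ext h
    rw [this] at hgb; exact zero_notMem_nonZeroDivisors hgb
  have hg₀eq' : g₀ = (ga : K) / (gb : K) := hg₀eq.symm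
  set g₁ : K := (gb : K) ^ p * g₀ with hg₁def
  have hg₁A : g₁ ∈ A := by
    have : g₁ = (ga : K) * (gb : K) ^ (p - 1) := by
      rw [hg₁def, hg₀eq']
      have hp1 : (gb : K) ^ p = (gb : K) ^ (p - 1) * (gb : K) := by
        rw [← pow_succ, Nat.sub_add_cancel hp.one_lt.le]
      rw [hp1, mul_assoc, mul_div_assoc', mul_div_cancel_left₀ _ hgb0, mul_comm]
    rw [this]; exact A.mul_mem ga.2 (A.pow_mem gb.2 _)
  have hg₁R₁ : g₁ ∈ R₁ := hSR₁ (hAS hg₁A)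
  have hg₁ : ∀ c : K, c ^ p ≠ g₁ := by
    intro c hc
    apply hg₀ (c / gb)
    rw [div_pow, hc, hg₁def, mul_div_cancel_left₀ _ (pow_ne_zero _ hgb0)]
  have hdefect₁ : ∀ f₀ : K, ∃ f₁ : K, O.valuation (g₁ - f₁ ^ p) < O.valuation (g₁ - f₀ ^ p) := by
    intro f₀
    obtain ⟨f₁, hf₁⟩ := hdefect (f₀ / gb)
    refine ⟨gb * f₁, ?_⟩
    have e1 : g₁ - ((gb : K) * f₁) ^ p = (gb : K) ^ p * (g₀ - f₁ ^ p) := by rw [hg₁def]; ring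
    have e2 : g₁ - f₀ ^ p = (gb : K) ^ p * (g₀ - (f₀ / gb) ^ p) := by
      rw [hg₁def, div_pow, mul_sub, mul_div_cancel₀ _ (pow_ne_zero _ hgb0)]
    rw [e1, e2, map_mul, map_mul]
    exact mul_lt_mul_of_pos_left hf₁ (by rw [map_pow]; exact pow_pos (zero_lt_iff.mpr ((Valuation.ne_zero_iff _).mpr hgb0)) _)
  -- D-abs, transported to `O₁`
  obtain ⟨D, s, hs, hDA₁, hDg₁⟩ := Lens5.AbsDerivation.absDerivation_of_forall_pow_ne' p hp k K A₁ hA₁fg hfrac₁ g₁ hg₁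
  have hDR₁ : ∀ y ∈ R₁, s * D y ∈ R₁ := mul_derivation_mem_locAtCentre D s hDA₁
  have hDO₁ : ∀ y : K, y ∈ O₁ → s * D y ∈ O₁ := fun y hy => mul_derivation_mem_of_isLocalization D s hDR₁ hloc₁.symm y hy
  -- Step 0: a best `v₁`-approximation
  have hπ : ∀ x : K, O₁.valuation x < 1 → O₁.valuation x ≤ O₁.valuation t :=
    valuation_le_of_lt_one O₁ R₁ hR₁O₁ hloc₁' ⟨t, ht⟩ htprime hvt
  have harch : ∀ x : K, x ≠ 0 → ∃ n : ℕ, O₁.valuation t ^ n ≤ O₁.valuation x :=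
    exists_pow_le_valuation O₁ R₁ hR₁O₁ hloc₁' ⟨t, ht⟩ htprime hvt
  obtain ⟨a, hbest⟩ := exists_best_pthPowerApprox_of_derivation p hp O₁ t ht0 hvt hπ harch D s hs hDO₁ g₁ (hR₁O₁ hg₁R₁) hDg₁
  -- Step 1: dichotomy; the ramified branch contradicts `hdefect`
  have hne : g₁ - a ^ p ≠ 0 := fun h => hg₁ a (sub_eq_zero.mp h).symm
  rcases bestApprox_dichotomy p O₁ g₁ a hbest hne with hram | ⟨c, hc0, hvc, -, -, hres⟩
  · exfalso
    obtain ⟨f₁, hf₁⟩ := hdefect₁ a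
    exact absurd (isMin_of_ramified_coarse p O O₁ hOO₁ g₁ a hram f₁) (not_le.mpr hf₁)
  -- GLUE 1
  obtain ⟨w, a', uu, m, hvw, hvuu, hrel, hresuu⟩ :=
    exists_bestApprox_data_in_frame p O₁ R₁ hR₁O₁ hloc₁' ⟨t, ht⟩ htprime hvt g₁ hg₁R₁ a c hc0 hvc hbest hres
  have hw0 : (w : K) ≠ 0 := ne_zero_of_valuation_eq_one hvw
  -- `u := uu` and its expression in the `K^p`-line of `g₀`
  set αK : K := (w : K) * (gb : K) / t ^ m with hαK
  set βK : K := -((a' : K) / t ^ m) with hβK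
  have hαK0 : αK ≠ 0 := div_ne_zero (mul_ne_zero hw0 hgb0) (pow_ne_zero _ ht0)
  have hueq : (uu : K) = αK ^ p * g₀ + βK ^ p := by
    have h1 : (uu : K) = ((w : K) ^ p * g₁ - (a' : K) ^ p) / t ^ (p * m) := by
      rw [hrel, mul_div_cancel_left₀ _ (pow_ne_zero _ ht0)]
    rw [h1, hαK, hβK, hg₁def, neg_pow, neg_one_pow_char K p, div_pow, div_pow, mul_pow, mul_comm p m, pow_mul]
    field_simp
    ring
  -- THE RESIDUE FRAME
  have hkO₁ : ∀ c : k, algebraMap k K c ∈ O₁ := fun c => hOO₁ (hA₁O (A₁.algebraMap_mem c))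
  letI : Algebra k (ResidueField O₁) :=
    ((residue O₁).comp ((algebraMap k K).codRestrict O₁.toSubring hkO₁)).toAlgebra
  have hcompat : ∀ c : k, algebraMap k (ResidueField O₁) c = residue O₁ ⟨algebraMap k K c, hOO₁ (hA₁O (A₁.algebraMap_mem c))⟩ :=
    fun c => rfl
  haveI : CharP (ResidueField O₁) p := charP_of_injective_algebraMap (algebraMap k (ResidueField O₁)).injective p
  obtain ⟨Ā, hĀim, hĀfg, hĀŌ, hfracĀ, hzdb, hSb, hregb, hdimb, -⟩ :=
    residueFrame O O₁ hOO₁ A₁ hA₁O hA₁fg hreg₁ hdim₁ hzd₁ hloc₁ t t₂ t₃ ht ht₂ ht₃ hmax₁ hvt hcompat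
  set Ō := residueValuationSubring O O₁ hOO₁ with hŌdef
  haveI : IsFractionRing Ā (ResidueField O₁) := hfracĀ
  -- `ū` is not a `p`-th power in `κ₁`
  have huO₁ : (uu : K) ∈ O₁ := hR₁O₁ uu.2
  set ub : ResidueField O₁ := residue O₁ ⟨(uu : K), huO₁⟩ with hub
  have hub' : ∀ cb : ResidueField O₁, cb ^ p ≠ ub := by
    intro cb hcb
    obtain ⟨d, rfl⟩ := residue_surjective cb
    have : residue O₁ (⟨(uu : K), huO₁⟩ - d ^ p) = 0 := by rw [map_sub, map_pow, hcb, sub_self]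
    rw [residue_eq_zero_iff] at this
    have hlt := (O₁.valuation_lt_one_iff _).mp this
    exact hresuu d d.2 hlt
  -- THE DOWNSTAIRS ASSEMBLY
  obtain ⟨Rb, hRb0, hstepb, M, hRM, -, cb, hcb, xb, yb, hxb0, hyb0, hxy, Lb, hLb, hden, hclean⟩ :=
    hD2 (ResidueField O₁) Ō Ā hĀŌ hĀfg hfracĀ hregb hdimb hzdb ub hub'
  -- THE SLICE up to the stage `M`
  have h0 : ((locAtCentre A₁.toSubring O).comap O₁.toSubring.subtype).map (residue O₁) = Rb 0 := by rw [hRb0]; exact hSb.symm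
  have h0dom : SubringDominates (Rb 0) Ō.toSubring := by rw [hRb0]; exact subringDominates_locAtCentre hĀŌ
  obtain ⟨AM, hAMO, hAAM, hAMfg, hregM, hR₁RM, himm⟩ := slice O O₁ hOO₁ A A₁ hAA₁ hA₁fg hA₁O hreg₁ Rb h0 h0dom hstepb M
  -- THE LIFT
  haveI := hRM
  have hlocM : O₁.toSubring ≤ locAtCentre (locAtCentre AM.toSubring O) O₁ := hloc₁'.trans (locAtCentre_mono O₁ hR₁RM)
  have hcentreM : ∃ r ∈ locAtCentre AM.toSubring O, r ≠ 0 ∧ O₁.valuation r < 1 := ⟨t, hR₁RM ht, ht0, hvt⟩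
  have hSdom : SubringDominates (Rb M) Ō.toSubring := (sequence_dominates h0dom hstepb M).1
  obtain ⟨A', hA'O, hAA', hA'fg, hreg', c', hc', hforms⟩ :=
    lift_clean p O O₁ hOO₁ A hAfg hzd hdimA AM hAAM hAMfg hAMO hregM hlocM hcentreM (uu : K) (hR₁RM uu.2) (Rb M) hSdom himm
      cb hcb xb yb hxb0 hyb0 hxy Lb hLb hden hclean
  -- CHANGE OF GENERATOR back to `g₀`
  obtain ⟨c'', hsum, hnt⟩ := lineRep_change_of_generator p g₀ αK βK hαK0 c'
  have hsum' : (∑ j : Fin p, c' j ^ p * (uu : K) ^ (j : ℕ)) = ∑ j : Fin p, c'' j ^ p * g₀ ^ (j : ℕ) := by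
    rw [← hsum]
    refine Finset.sum_congr rfl fun j _ => ?_
    rw [hueq]
  refine ⟨A', hA'O, hAA', hA'fg, hreg', c'', hnt hc', ?_⟩
  rw [← hsum']
  exact hforms


/-- **(C-div), general divisorial case, modulo `hEmb`, `CossartJannsenSaito2020General` and the downstairs package `hD2`.**  See the module
docstring and `cleanLU3Defect_of_divisorialCoarsening_of`. [folklore] -/
theorem cleanLU3Defect_of_divisorialCoarsening_of_cleanMono
    (hEmb : ∀ (Z : Scheme.{0}) [IsIntegral Z] [IsNoetherian Z], Scheme.IsRegular Z →
      Scheme.IsExcellent Z → ∀ (X : Set Z), IsClosed X → X ≠ Set.univ → topologicalKrullDim X ≤ 2 →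
        ∃ (Z' : Scheme.{0}) (π : Z' ⟶ Z), IsProper π ∧ Function.Surjective π.base ∧
          (∃ U : Z.Opens, (U : Set Z) = Xᶜ ∧ IsIso (π ∣_ U)) ∧
          IsStrictNormalCrossingsDivisor Z' (π.base ⁻¹' X))
    (h78 : CossartJannsenSaito2020General.{0})
    (p : ℕ) (hp : p.Prime) (k : Type) [Field k] [CharP k p]
    (hD2 : ∀ (κ : Type) [Field κ] [CharP κ p] [Algebra k κ]
      (Ō : ValuationSubring κ) (Ā : Subalgebra k κ), Ā.toSubring ≤ Ō.toSubring → Ā.FG → IsFractionRing Ā κ →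
      IsRegularLocalRing (locAtCentre Ā.toSubring Ō) →
      ringKrullDim (locAtCentre Ā.toSubring Ō) = 2 →
      (∀ (T : Subring κ) (hT : T ≤ Ō.toSubring), Ā.toSubring ≤ T → (subringCentre T Ō hT).IsMaximal) →
      ∀ ū : κ, (∀ c : κ, c ^ p ≠ ū) →
      ∃ (Rb : ℕ → Subring κ), Rb 0 = locAtCentre Ā.toSubring Ō ∧ (∀ i, IsQuadraticTransformAlong Ō (Rb i) (Rb (i + 1))) ∧
        ∃ (M : ℕ) (_ : IsRegularLocalRing (Rb M)), ringKrullDim (Rb M) = 2 ∧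
        ∃ (c : Fin p → κ), (∃ j : Fin p, (j : ℕ) ≠ 0 ∧ c j ≠ 0) ∧
        ∃ (xb yb : Rb M), (xb : κ) ≠ 0 ∧ (yb : κ) ≠ 0 ∧ maximalIdeal (Rb M) = Ideal.span {xb, yb} ∧
        ∃ (Lb : List (κ × κ × ℕ)),
          (∀ t ∈ Lb, t.1 ≠ 0 ∧ ∃ (h₁ : t.1 ∈ Rb M) (h₂ : t.2.1 ∈ Rb M), maximalIdeal (Rb M) = Ideal.span {⟨_, h₁⟩, ⟨_, h₂⟩}) ∧
          (∀ j : Fin p, c j * (Lb.map fun t => t.1 ^ t.2.2).prod ∈ Rb M) ∧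
          ((∃ (a b : ℕ) (ε : Rb M), IsUnit ε ∧ (a ≠ 0 ∨ b ≠ 0) ∧ (a = 0 ∨ ¬ p ∣ a) ∧ (b = 0 ∨ ¬ p ∣ b) ∧
              (∑ j : Fin p, c j ^ p * ū ^ (j : ℕ)) = (ε : κ) * (xb : κ) ^ a * (yb : κ) ^ b) ∨
            (∃ w : Rb M, IsUnit w ∧ (∑ j : Fin p, c j ^ p * ū ^ (j : ℕ)) = (w : κ) ∧ ∀ c' : Rb M, w - c' ^ p ∉ maximalIdeal (Rb M)) ∨
            (∃ s c' : Rb M, (∑ j : Fin p, c j ^ p * ū ^ (j : ℕ)) = (s : κ) ∧ s - c' ^ p ∈ maximalIdeal (Rb M) ∧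
              s - c' ^ p ∉ maximalIdeal (Rb M) ^ 2)))
    (K : Type) [Field K] [Algebra k K]
    (O : ValuationSubring K) (A : Subalgebra k K) (hAO : A.toSubring ≤ O.toSubring) (hAfg : A.FG)
    (hfrac : IsFractionRing A K)
    (hreg : IsRegularLocalRing (locAtCentre A.toSubring O))
    (hdim3 : ringKrullDim (locAtCentre A.toSubring O) = 3)
    (hzd : ∀ (T : Subring K) (hT : T ≤ O.toSubring), A.toSubring ≤ T → (subringCentre T O hT).IsMaximal)
    (g₀ : K) (hg₀ : ∀ c : K, c ^ p ≠ g₀)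
    (hdefect : ∀ f₀ : K, ∃ f₁ : K, O.valuation (g₀ - f₁ ^ p) < O.valuation (g₀ - f₀ ^ p))
    (O₁ : ValuationSubring K) (hOO₁ : O ≤ O₁) (hO₁ : O₁ ≠ ⊤)
    (y : Fin 2 → K) (hy : ∀ i, y i ∈ O)
    (hind : ∀ P : MvPolynomial (Fin 2) k, P ≠ 0 → O₁.valuation (MvPolynomial.aeval y P) = 1) :
    ∃ (A' : Subalgebra k K), A'.toSubring ≤ O.toSubring ∧ A ≤ A' ∧ A'.FG ∧
    ∃ (_ : IsRegularLocalRing (locAtCentre A'.toSubring O)) (c : Fin p → K), (∃ j : Fin p, (j : ℕ) ≠ 0 ∧ c j ≠ 0) ∧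
    ((∃ (d m : ℕ) (hmd : m ≤ d) (t : Fin d → ↥(locAtCentre A'.toSubring O)) (a : Fin m → ℕ) (u : ↥(locAtCentre A'.toSubring O)), IsUnit u ∧
    Ideal.span (Set.range t) = IsLocalRing.maximalIdeal ↥(locAtCentre A'.toSubring O) ∧
    ringKrullDim ↥(locAtCentre A'.toSubring O) = (d : WithBot ℕ∞) ∧ 0 < m ∧ (∀ i, ¬ p ∣ a i) ∧
    (∑ j : Fin p, c j ^ p * g₀ ^ (j : ℕ)) = (u : K) * ∏ i : Fin m, ((t (Fin.castLE hmd i) : ↥(locAtCentre A'.toSubring O)) : K) ^ (a i)) ∨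
    (∃ u : ↥(locAtCentre A'.toSubring O), IsUnit u ∧ (∑ j : Fin p, c j ^ p * g₀ ^ (j : ℕ)) = (u : K) ∧
    ∀ c' : ↥(locAtCentre A'.toSubring O), u - c' ^ p ∉ IsLocalRing.maximalIdeal ↥(locAtCentre A'.toSubring O)) ∨
    (∃ s c' : ↥(locAtCentre A'.toSubring O), (∑ j : Fin p, c j ^ p * g₀ ^ (j : ℕ)) = (s : K) ∧
    s - c' ^ p ∈ IsLocalRing.maximalIdeal ↥(locAtCentre A'.toSubring O) ∧
    s - c' ^ p ∉ IsLocalRing.maximalIdeal ↥(locAtCentre A'.toSubring O) ^ 2)) := by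
  classical
  haveI : IsFractionRing A K := hfrac
  have hne : O ≠ O₁ := ne_of_residually_independent O O₁ A hAO hAfg hzd y hy hind
  -- a regular model `A₃ ⊇ A ∪ {y₀, y₁}` along `O`
  obtain ⟨A₃, hA₃O, hAA₃, hA₃fg, hyA₃, hreg₃⟩ := exists_regular_model_containing h78 O O₁ hOO₁ hne hO₁ A hAO hAfg
    hreg hdim3 hzd (Finset.univ.image y) (by
      intro z hz
      rw [Finset.coe_image] at hz
      obtain ⟨i, -, rfl⟩ := hz
      exact hy i)
  have hyA₃' : ∀ i, y i ∈ A₃ := fun i => hyA₃ (by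
    rw [Finset.coe_image]; exact ⟨i, Finset.mem_coe.mpr (Finset.mem_univ i), rfl⟩)
  haveI hfrac₃ : IsFractionRing A₃ K := isFractionRing_of_le hAA₃ hfrac
  have hzd₃ : ∀ (T : Subring K) (hT : T ≤ O.toSubring), A₃.toSubring ≤ T → (subringCentre T O hT).IsMaximal :=
    fun T hT h => hzd T hT (le_trans (fun z hz => hAA₃ hz) h)
  -- dimensions
  have hdimA : ringKrullDim A = 3 := by
    rw [← ringKrullDim_locAtCentre_eq_of_isMaximal A hAfg O hAO (hzd _ hAO le_rfl)]; exact hdim3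
  have hdimA₃ : ringKrullDim A₃ = 3 := by
    rw [ringKrullDim_eq_of_fg_of_le hAfg hA₃fg hAA₃]; exact hdimA
  have hdim3₃ : ringKrullDim (locAtCentre A₃.toSubring O) = 3 := by
    rw [ringKrullDim_locAtCentre_eq_of_isMaximal A₃ hA₃fg O hA₃O (hzd₃ _ hA₃O le_rfl)]; exact hdimA₃
  -- the centre of `O₁` on `locAtCentre A₃ O` has height one
  have hloc₃ : locAtCentre (locAtCentre A₃.toSubring O) O₁ = O₁.toSubring :=
    locAtCentre_locAtCentre_eq_of_residually_independent hOO₁ hO₁ A₃ hA₃O hA₃fg hreg₃ hdimA₃ y hyA₃' hind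
  obtain ⟨A', hA'O, hA₃A', hA'fg, hrest⟩ := cleanLU3Defect_of_heightOneCoarsening_of_cleanMono hEmb p hp k hD2 K O A₃
    hA₃O hA₃fg hfrac₃ hreg₃ hdim3₃ hzd₃ g₀ hg₀ hdefect O₁ hOO₁ hO₁ hloc₃
  exact ⟨A', hA'O, hAA₃.trans hA₃A', hA'fg, hrest⟩


end Summit.ResolutionOfSingularities.ResolutionOfSingularities.Theorems.RadicialJung.CleanModels

end
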